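import Summits.BirchSwinnertonDyer.BirchSwinnertonDyer.Theorems.ByReductionTypeAtTwoFineSelmerConjAAtTwoAdditivePotGoodNarrowRankCertificate316Cubic
import Summits.BirchSwinnertonDyer.BirchSwinnertonDyer.Theorems.ByReductionTypeAtTwoFineSelmerConjAAtTwoAdditivePotGoodNarrowDefectCertificate1257Embeddings
import HarnessLib

/-!
# Route `ByReductionTypeAtTwo` (rung K4), crux C1″ `FineSelmerConjAAtTwoAdditivePotGood` (item stmt-BirchSwinnertonDyer-22615):
# THE LAYER-`1` FIELD `A₁ = ℚ(θ) ⊔ ℚ_1 = ℚ(θ, √2)` OF THE CUBIC FIELD OF DISCRIMINANT `316` (`θ³ − θ² − 4θ + 2 = 0`, point field of the census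
# row `261648q1`), PART A — totally real sextic and its six real embeddings by COUNTING (KERNEL)
# (a `--supports 22615` file; seat `bsd-2adic-k4-w1` GEN 11; sequel of `…NarrowRankCertificate316Cubic`; the twin of GEN 10's `…63644Layer`)

HONEST FRAMING (cell `bsd-2adic`, D-0036/D-0054/D-0152): KERNEL theorems about ONE totally real sextic field `A₁ = ℚ(θ) ⊔ ℚ_1 = ℚ(θ, √2)`
(`ℚ_1` the first layer of the cyclotomic `ℤ₂`-extension of `ℚ`); no elliptic curve, no named fact, no `sorry`, no definition. Closes nothing at the
`∀`-level; nothing booked; BSD is not proved by any of this.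

As for `d = 63644` (GEN 10): the basic data of `A₁` (totally real of degree `6`) is taken from the restricted cyclotomic tower (`isTotallyReal_layer`,
`finrank_layer_restrict`), and the real embeddings are obtained by counting (`ρ ↦ (ρ|_{ℚ(θ)}, ρ(√2))` is injective into the `6`-set `Emb(ℚ(θ)) × {±√2}`).

* `layer_one_basics_d316` — `A₁` totally real, `[A₁ : ℚ] = 6`, `[ℚ(θ) : ℚ] = 3`.
* `exists_ringHom_sup_layer_one_d316` — every pair `(φ, ±√2)` is realised by a real embedding of `A₁`.

References: [FrohlichTaylor1990] Ch. V §1 (1.10)–(1.13); [Cohen1993] §4.1.3; [Washington1997] §13.1 (`ℚ_1 = ℚ(√2)`), Prop. 13.2.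
-/

set_option autoImplicit false
-- sibling precedent: the directory name repeats the summit name
set_option linter.dupNamespace false

noncomputable section

open scoped Classical IntermediateField NumberField

namespace Summit.BirchSwinnertonDyer.BirchSwinnertonDyer.Theorems.AddKatoTwo

open Polynomial IsDedekindDomain NumberField Field IntermediateField
  Literature.NumberTheory.EllipticCurves Literature.NumberTheory.EllipticCurves.ZpExtension
  Literature.NumberTheory.IwasawaTheory Literature.NumberTheory.NumberFields
  Literature.NumberTheory.GaloisRepresentations Literature.Geometry.Kaehler.ComplexTorus

variable {θ : AlgebraicClosure ℚ}

set_option maxHeartbeats 400000 in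
/-- **The basic data of `A = ℚ(θ) ⊔ ℚ_1` for `d = 316`: totally real, degree `6`, and `[ℚ(θ):ℚ] = 3`** — from the restricted cyclotomic
`ℤ₂`-tower of `ℚ(θ)` (odd degree, so the cyclotomic character restricts onto): its first layer is `≅ ℚ(θ) ⊔ ℚ_1`, totally real as a layer of a
`ℤ₂`-extension of a totally real field, of degree `3·2`. No hypothesis on the primes above `2`. [cite: Washington1997, §13.1 and Prop. 13.2] -/
theorem layer_one_basics_d316 (hθ : aeval θ (Cubic.toPoly ⟨1, ((-1 : ℤ) : ℚ), ((-4 : ℤ) : ℚ), ((2 : ℤ) : ℚ)⟩) = 0) :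
    haveI : FiniteDimensional ℚ ↥ℚ⟮θ⟯ :=
      IntermediateField.adjoin.finiteDimensional ⟨_, Cubic.monic_of_a_eq_one', by rwa [← aeval_def]⟩
    haveI : FiniteDimensional ℚ ↥((CyclotomicZp.zpExtension 2).layer 1) := (CyclotomicZp.zpExtension 2).finiteDimensional_layer_holds 1
    haveI : NumberField ↥(ℚ⟮θ⟯ ⊔ (CyclotomicZp.zpExtension 2).layer 1) := NumberField.mk
    IsTotallyReal ↥(ℚ⟮θ⟯ ⊔ (CyclotomicZp.zpExtension 2).layer 1) ∧
      Module.finrank ℚ ↥(ℚ⟮θ⟯ ⊔ (CyclotomicZp.zpExtension 2).layer 1) = 6 ∧ Module.finrank ℚ ↥ℚ⟮θ⟯ = 3 := by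
  haveI : FiniteDimensional ℚ ↥ℚ⟮θ⟯ :=
    IntermediateField.adjoin.finiteDimensional ⟨_, Cubic.monic_of_a_eq_one', by rwa [← aeval_def]⟩
  haveI : FiniteDimensional ℚ ↥((CyclotomicZp.zpExtension 2).layer 1) := (CyclotomicZp.zpExtension 2).finiteDimensional_layer_holds 1
  haveI : NumberField ↥ℚ⟮θ⟯ := NumberField.mk
  haveI : NumberField ↥(ℚ⟮θ⟯ ⊔ (CyclotomicZp.zpExtension 2).layer 1) := NumberField.mk
  haveI : IsTotallyReal ↥ℚ⟮θ⟯ := isTotallyReal_adjoin_d316 hθ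
  set κ := CyclotomicZp.zpExtension 2 with hκdef
  have h3 : Module.finrank ℚ ↥ℚ⟮θ⟯ = 3 := finrank_adjoin_eq_three_of_irreducible irreducible_cubic_d316p hθ
  have hodd3 : Odd (Module.finrank ℚ ↥ℚ⟮θ⟯) := by rw [h3]; decide
  have hsurj := surjective_comp_absGaloisRestrict_cyclotomicZp_of_odd ℚ⟮θ⟯ hodd3
  set κE := κ.restrict ↥ℚ⟮θ⟯ hsurj with hκE
  haveI : FiniteDimensional ↥ℚ⟮θ⟯ (κE.layer 1) := κE.finiteDimensional_layer_holds 1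
  haveI : NumberField (κE.layer 1) := NumberField.of_module_finite ↥ℚ⟮θ⟯ _
  obtain ⟨f⟩ := nonempty_algEquiv_layer_restrict_fieldRange_sup_layer κ ↥ℚ⟮θ⟯ hsurj (ℚ⟮θ⟯).val 1
  have hrange : (ℚ⟮θ⟯).val.fieldRange ⊔ κ.layer 1 = ℚ⟮θ⟯ ⊔ κ.layer 1 := by rw [fieldRange_val]
  set e : ↥(κE.layer 1) ≃ₐ[ℚ] ↥(ℚ⟮θ⟯ ⊔ κ.layer 1) := f.trans (equivOfEq hrange) with hedef
  haveI : IsTotallyReal ↥(κE.layer 1) := isTotallyReal_layer κE 1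
  refine ⟨IsTotallyReal.ofRingEquiv e.toRingEquiv, ?_, h3⟩
  rw [← e.toLinearEquiv.finrank_eq, finrank_layer_restrict κ ↥ℚ⟮θ⟯ hsurj 1, h3]
  norm_num

set_option maxHeartbeats 400000 in
/-- **The real embeddings of `A = ℚ(θ) ⊔ ℚ_1` (`d = 316`) realise every pair `(φ, ±√2)`**, `φ` a real embedding of `ℚ(θ)`: `A` is
totally real of degree `6`, `ρ ↦ (ρ|_{ℚ(θ)}, ρ(√2))` is injective (`A = ℚ(θ)(√2)`, `√2 ∉ ℚ(θ)` by odd degree) with image in the `6`-set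
`Emb(ℚ(θ)) × {±√2}`. [cite: FrohlichTaylor1990, Ch. V §1 ("the embeddings N ↪ ℝ"), p. 163] [cite: Washington1997, §13.1] [cite: Cohen1993, §4.1.3] -/
theorem exists_ringHom_sup_layer_one_d316 (hθ : aeval θ (Cubic.toPoly ⟨1, ((-1 : ℤ) : ℚ), ((-4 : ℤ) : ℚ), ((2 : ℤ) : ℚ)⟩) = 0)
    {t : AlgebraicClosure ℚ} (ht : t ∈ (CyclotomicZp.zpExtension 2).layer 1) (ht2 : t ^ 2 = 2)
    (φ : ↥ℚ⟮θ⟯ →+* ℝ) (y : ℝ) (hy : y = Real.sqrt 2 ∨ y = -Real.sqrt 2) :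
    ∃ ρ : ↥(ℚ⟮θ⟯ ⊔ (CyclotomicZp.zpExtension 2).layer 1) →+* ℝ,
      (∀ c : ↥ℚ⟮θ⟯, ρ (inclusion (le_sup_left : ℚ⟮θ⟯ ≤ ℚ⟮θ⟯ ⊔ (CyclotomicZp.zpExtension 2).layer 1) c) = φ c) ∧
      ρ ⟨t, (le_sup_right : (CyclotomicZp.zpExtension 2).layer 1 ≤ _) ht⟩ = y := by
  haveI : FiniteDimensional ℚ ↥ℚ⟮θ⟯ :=
    IntermediateField.adjoin.finiteDimensional ⟨_, Cubic.monic_of_a_eq_one', by rwa [← aeval_def]⟩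
  haveI : FiniteDimensional ℚ ↥((CyclotomicZp.zpExtension 2).layer 1) := (CyclotomicZp.zpExtension 2).finiteDimensional_layer_holds 1
  haveI : NumberField ↥ℚ⟮θ⟯ := NumberField.mk
  haveI : NumberField ↥(ℚ⟮θ⟯ ⊔ (CyclotomicZp.zpExtension 2).layer 1) := NumberField.mk
  obtain ⟨hreal, hfinA, h3⟩ := layer_one_basics_d316 hθ
  haveI := hreal
  have hKA : ℚ⟮θ⟯ ≤ ℚ⟮θ⟯ ⊔ ((CyclotomicZp.zpExtension 2).layer 1) := le_sup_left
  have htA : t ∈ ℚ⟮θ⟯ ⊔ ((CyclotomicZp.zpExtension 2).layer 1) := (le_sup_right : ((CyclotomicZp.zpExtension 2).layer 1) ≤ ℚ⟮θ⟯ ⊔ ((CyclotomicZp.zpExtension 2).layer 1)) ht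
  set t' : ↥(ℚ⟮θ⟯ ⊔ ((CyclotomicZp.zpExtension 2).layer 1)) := ⟨t, htA⟩ with ht'def
  have ht'2 : t' ^ 2 = 2 := by
    apply (algebraMap ↥(ℚ⟮θ⟯ ⊔ ((CyclotomicZp.zpExtension 2).layer 1)) (AlgebraicClosure ℚ)).injective
    rw [map_pow, map_ofNat]
    exact ht2
  letI : Algebra ℚ⟮θ⟯ ↥(ℚ⟮θ⟯ ⊔ ((CyclotomicZp.zpExtension 2).layer 1)) := (inclusion hKA).toRingHom.toAlgebra
  have halg : ∀ c : ℚ⟮θ⟯, algebraMap ℚ⟮θ⟯ ↥(ℚ⟮θ⟯ ⊔ ((CyclotomicZp.zpExtension 2).layer 1)) c = inclusion hKA c := fun _ => rfl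
  haveI : IsScalarTower ℚ ℚ⟮θ⟯ ↥(ℚ⟮θ⟯ ⊔ ((CyclotomicZp.zpExtension 2).layer 1)) := IsScalarTower.of_algebraMap_eq fun q => ((inclusion hKA).commutes q).symm
  haveI : Module.Finite ℚ⟮θ⟯ ↥(ℚ⟮θ⟯ ⊔ ((CyclotomicZp.zpExtension 2).layer 1)) := Module.Finite.of_restrictScalars_finite ℚ ℚ⟮θ⟯ _
  have hdeg : Module.finrank ℚ⟮θ⟯ ↥(ℚ⟮θ⟯ ⊔ ((CyclotomicZp.zpExtension 2).layer 1)) = 2 := by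
    have htower := Module.finrank_mul_finrank ℚ ℚ⟮θ⟯ ↥(ℚ⟮θ⟯ ⊔ ((CyclotomicZp.zpExtension 2).layer 1))
    rw [h3, hfinA] at htower
    omega
  -- `√2 ∉ ℚ⟮θ⟯` (odd degree)
  have htK : t' ∉ Set.range (algebraMap ℚ⟮θ⟯ ↥(ℚ⟮θ⟯ ⊔ ((CyclotomicZp.zpExtension 2).layer 1))) := by
    rintro ⟨c, hc⟩
    have hc2 : c ^ 2 = 2 := by
      apply (algebraMap ℚ⟮θ⟯ ↥(ℚ⟮θ⟯ ⊔ ((CyclotomicZp.zpExtension 2).layer 1))).injective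
      rw [map_pow, hc, ht'2, map_ofNat]
    have hcQ : (c : AlgebraicClosure ℚ) ^ 2 = 2 := by
      have := congrArg (fun z : ↥ℚ⟮θ⟯ => (z : AlgebraicClosure ℚ)) hc2
      push_cast at this
      exact this
    have hcint : IsIntegral ℚ (c : AlgebraicClosure ℚ) := ⟨X ^ 2 - C 2, monic_X_pow_sub_C _ two_ne_zero, by simp [hcQ]⟩
    have hcnot : (c : AlgebraicClosure ℚ) ∉ (algebraMap ℚ (AlgebraicClosure ℚ)).range := by
      rintro ⟨q, hq⟩
      have h1 : (algebraMap ℚ (AlgebraicClosure ℚ)) (q ^ 2) = algebraMap ℚ (AlgebraicClosure ℚ) 2 := by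
        rw [map_pow, hq, hcQ, map_ofNat]
      have h2 : q ^ 2 = 2 := (algebraMap ℚ (AlgebraicClosure ℚ)).injective h1
      have hq2 : ((q : ℝ)) ^ 2 = 2 := by exact_mod_cast h2
      exact irrational_sqrt_two ⟨|q|, by rw [Rat.cast_abs, ← Real.sqrt_sq_eq_abs, hq2]⟩
    have hdeg2 : Module.finrank ℚ ↥ℚ⟮(c : AlgebraicClosure ℚ)⟯ = 2 := by
      rw [IntermediateField.adjoin.finrank hcint]
      have hle := (minpoly.two_le_natDegree_iff hcint).mpr hcnot
      have hle' : (minpoly ℚ (c : AlgebraicClosure ℚ)).natDegree ≤ 2 := by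
        have hd := minpoly.degree_le_of_ne_zero ℚ (c : AlgebraicClosure ℚ) (p := X ^ 2 - C (2 : ℚ))
          (monic_X_pow_sub_C (2 : ℚ) two_ne_zero).ne_zero (by simp [hcQ])
        rw [degree_X_pow_sub_C two_pos] at hd
        exact natDegree_le_iff_degree_le.mpr hd
      omega
    have hdvd : Module.finrank ℚ ↥ℚ⟮(c : AlgebraicClosure ℚ)⟯ ∣ Module.finrank ℚ ℚ⟮θ⟯ :=
      finrank_dvd_of_le_right ((adjoin_simple_le_iff).mpr c.2)
    rw [hdeg2, h3] at hdvd
    omega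
  -- `A = ℚ⟮θ⟯(t')`: every element is a polynomial in `t'` over `ℚ⟮θ⟯`
  have htint : IsIntegral ℚ⟮θ⟯ t' := (Algebra.IsIntegral.isIntegral (R := ℚ) t').tower_top
  have hgen : IntermediateField.adjoin ℚ⟮θ⟯ ({t'} : Set ↥(ℚ⟮θ⟯ ⊔ ((CyclotomicZp.zpExtension 2).layer 1))) = ⊤ := by
    have h2le : 2 ≤ (minpoly ℚ⟮θ⟯ t').natDegree := (minpoly.two_le_natDegree_iff htint).mpr htK
    refine IntermediateField.eq_of_le_of_finrank_eq le_top ?_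
    rw [IntermediateField.adjoin.finrank htint, IntermediateField.finrank_top', hdeg]
    exact le_antisymm ((minpoly.natDegree_le (A := ↥ℚ⟮θ⟯) (x := t')).trans hdeg.le) h2le
  have hpoly : ∀ z : ↥(ℚ⟮θ⟯ ⊔ ((CyclotomicZp.zpExtension 2).layer 1)), ∃ f : ℚ⟮θ⟯[X], z = aeval t' f := by
    intro z
    have hz : z ∈ (IntermediateField.adjoin ℚ⟮θ⟯ ({t'} : Set ↥(ℚ⟮θ⟯ ⊔ ((CyclotomicZp.zpExtension 2).layer 1)))).toSubalgebra := by
      rw [hgen, IntermediateField.top_toSubalgebra]; exact Algebra.mem_top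
    rw [IntermediateField.adjoin_simple_toSubalgebra_of_isAlgebraic htint.isAlgebraic, Algebra.adjoin_singleton_eq_range_aeval] at hz
    obtain ⟨f, hf⟩ := hz
    exact ⟨f, hf.symm⟩
  have hinj : ∀ ρ ρ' : ↥(ℚ⟮θ⟯ ⊔ ((CyclotomicZp.zpExtension 2).layer 1)) →+* ℝ, ρ.comp (algebraMap ℚ⟮θ⟯ ↥(ℚ⟮θ⟯ ⊔ ((CyclotomicZp.zpExtension 2).layer 1))) = ρ'.comp (algebraMap ℚ⟮θ⟯ ↥(ℚ⟮θ⟯ ⊔ ((CyclotomicZp.zpExtension 2).layer 1))) →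
      ρ t' = ρ' t' → ρ = ρ' := by
    intro ρ ρ' hc hval
    refine RingHom.ext fun z => ?_
    obtain ⟨f, rfl⟩ := hpoly z
    rw [aeval_def, hom_eval₂, hom_eval₂, hc, hval]
  -- counting
  have hcardA : Fintype.card (↥(ℚ⟮θ⟯ ⊔ ((CyclotomicZp.zpExtension 2).layer 1)) →+* ℝ) = 6 := by rw [card_realEmbeddings, hfinA]
  haveI : IsTotallyReal ↥ℚ⟮θ⟯ := isTotallyReal_adjoin_d316 hθ
  have hcardK : Fintype.card (↥ℚ⟮θ⟯ →+* ℝ) = 3 := by rw [card_realEmbeddings, h3]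
  obtain ⟨hs2l, hs2u⟩ := sqrt_two_bounds'
  have hsne : Real.sqrt 2 ≠ -Real.sqrt 2 := by intro h; linarith
  set Φ : (↥(ℚ⟮θ⟯ ⊔ ((CyclotomicZp.zpExtension 2).layer 1)) →+* ℝ) → (↥ℚ⟮θ⟯ →+* ℝ) × ℝ := fun ρ => (ρ.comp (algebraMap ℚ⟮θ⟯ ↥(ℚ⟮θ⟯ ⊔ ((CyclotomicZp.zpExtension 2).layer 1))), ρ t') with hΦ
  set S : Finset ((↥ℚ⟮θ⟯ →+* ℝ) × ℝ) := (Finset.univ : Finset (↥ℚ⟮θ⟯ →+* ℝ)) ×ˢ ({Real.sqrt 2, -Real.sqrt 2} : Finset ℝ) with hS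
  have hΦinj : Function.Injective Φ := fun ρ ρ' h => hinj ρ ρ' (congrArg Prod.fst h) (congrArg Prod.snd h)
  have hsub : Finset.univ.image Φ ⊆ S := by
    intro p hp
    obtain ⟨ρ, -, rfl⟩ := Finset.mem_image.mp hp
    rw [hS, Finset.mem_product]
    refine ⟨Finset.mem_univ _, ?_⟩
    have hsq : (ρ t') ^ 2 = (Real.sqrt 2) ^ 2 := by
      rw [← map_pow, ht'2, map_ofNat, Real.sq_sqrt (by norm_num)]
    rcases sq_eq_sq_iff_eq_or_eq_neg.mp hsq with h | h
    · simp [hΦ, h]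
    · simp [hΦ, h]
  have hcardS : S.card = 6 := by
    rw [hS, Finset.card_product, Finset.card_univ, hcardK, Finset.card_pair hsne]
  have hcardI : (Finset.univ.image Φ).card = 6 := by
    rw [Finset.card_image_of_injective _ hΦinj, Finset.card_univ, hcardA]
  have heq : Finset.univ.image Φ = S := Finset.eq_of_subset_of_card_le hsub (by rw [hcardS, hcardI])
  have hmem : (φ, y) ∈ Finset.univ.image Φ := by
    rw [heq, hS, Finset.mem_product]
    refine ⟨Finset.mem_univ _, ?_⟩
    rcases hy with h | h <;> simp [h]
  obtain ⟨ρ, -, hρ⟩ := Finset.mem_image.mp hmem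
  refine ⟨ρ, fun c => ?_, congrArg Prod.snd hρ⟩
  have h1 := congrArg Prod.fst hρ
  simp only [hΦ] at h1
  rw [← halg, ← RingHom.comp_apply, h1]

end Summit.BirchSwinnertonDyer.BirchSwinnertonDyer.Theorems.AddKatoTwo

end
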